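import Summits.QuantumFields.YangMills.Theorems.SwapVirialDeficitSectorLaplaceEndGaussSlabSide
import HarnessLib

/-!
# `stub_end_gaussCore` ASSEMBLY, PART A (slab side with the N2 weight `W(t) = A·D(x₀,y₀) + T`): matched part smeared, tail part by the plain slab bound
# (skeleton ➎; LEAD sfw-p2 g99 memo11 §1(d)/§3 + memo11b (4): `W(t) = e^{½}(2π/b′)^{d/2}·D(t) + T_b`; free-hands support of ⟨stmt-QuantumFields-24197⟩
# `SwapVirialDeficit.SwapGluedStiffness`)

N2 (w2) delivers the pointwise fibre bound `hF` of ✓`lintegral_hubSlab_leader_le` with ONE weight `W(t) = A·D(x₀,y₀) + T`: `A·D` the matched follower determinant factor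
(`D` `E`-constant on sup-balls of radius `ρ` in the base letters), `T` a pure threshold tail, rates `c₁, c₂, c₃` (memo11b: `(b/6)/(52800L⁶)`, `b/3600L⁶`, `b/10800L⁶`).
This file turns that into the slab-side number: the `D`-part by ✓`slab_le_smeared`, the `T`-part by ✓`lintegral_endSlab_le`:
* ★★★ `endGauss_slab_le_of_N2` :
  `∫⁻_{|δ|<s} g dμ_B ≤ ofReal(π²/c₁·π²/c₂·2C₃/((1+c₃)√(1+c₃))) · (A·(E·ofReal(900 s^{1/3}(2ρ)^{2/3}/((2ρ)(2ρ))) + ofReal s)·∫⁻ D·w + T·ofReal(36 s^{1/3} + π² s))`.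
Downstream (assembler, SPEC w3 g67 2026-08-31 22:57Z = memo11): `g = 𝟙_{G♭}·ofReal(e^{−bF̂})`, `s = √τ`, shell comparison of `∫ D·w` (✓`mbDensity_ge_detFol_rescaled′`,
✓`endShell_weight_ge`, ✓`mbMain_ge_of_subset`), rate form, ✓`gaussCore_of_rate_window`, ✓`gaussCore_target_of_shell`.

HONEST LABEL: composition of landed lemmas; `stub_end_gaussCore` (N2 w2, final assembly) and stubs core-tip ∕ 001-good, ⟨24197⟩ ∕ ⟨24194⟩ and every rung OPEN; own crux ⟨22884⟩
OPEN (blocked-on ⟨19935⟩); the Yang–Mills mass gap is NOT proved; no summit is proved by a line.  THEOREMS ONLY (0 `def`, 0 `sorry`), standard axioms.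
Width seat ym-line-sfw-p2-w3 g67 (cell ym-idea-1, free hands), `--supports stmt-QuantumFields-24197`.  References: [folklore].
-/

set_option autoImplicit false
set_option synthInstance.maxSize 1024

noncomputable section

open MeasureTheory Set Real Metric
open scoped ENNReal

namespace Summit.QuantumFields.YangMills.Theorems.SwapVirialDeficit.SigmaBall

open Summit.QuantumFields.YangMills.Theorems.SwapVirialDeficit.Gnomonic (gnomonicWeight normSq3)
open Summit.QuantumFields.YangMills.Theorems.SwapVirialDeficit.BlowUpRing

variable {L : ℕ} [NeZero L]

/-- ★★★ **SLAB SIDE OF `stub_end_gaussCore` FROM THE N2 WEIGHT `W = A·D + T`.** For `0 < s ≤ 1`, `0 < ρ ≤ 1`, rates `c₁ c₂ c₃ > 0`, a measurable `g ≥ 0` on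
`ℝ × GnoCoord L`, a measurable base factor `D` with `D p ≤ E·D p′` for `dist p p′ < ρ`, and constants `A T : ℝ≥0∞` (any): IF the pointwise fibre bound holds at every leader
point with `|δ| < s` with weight `A·D(x₀,y₀) + T` and `r = B₀`, THEN
`∫⁻_{|δ|<s} g dμ_B ≤ K(c) · ((A·(E·ofReal(900 s^{1/3}(2ρ)^{1/3}(2ρ)^{1/3}((2ρ)(2ρ))⁻¹) + ofReal s))·∫⁻ D·w + T·ofReal(36 s^{1/3} + π² s))`,
`K(c) = ofReal(π²/c₁·(π²/c₂)·(2C₃/((1+c₃)√(1+c₃))))`. [folklore] -/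
theorem endGauss_slab_le_of_N2 {s ρ c₁ c₂ c₃ : ℝ} (hs0 : 0 < s) (hs1 : s ≤ 1) (hρ0 : 0 < ρ) (hρ1 : ρ ≤ 1) (hc₁ : 0 < c₁) (hc₂ : 0 < c₂) (hc₃ : 0 < c₃)
    (g : ℝ × GnoCoord L → ℝ≥0∞) (hg : Measurable g) {E A T : ℝ≥0∞} (D : ℝ × ℝ → ℝ≥0∞) (hDm : Measurable D)
    (hD : ∀ p p' : ℝ × ℝ, dist p p' < ρ → D p ≤ E * D p')
    (hN2 : ∀ (u : ℝ × ℝ) (t : Fin 3 → ℝ) (v : Fin 2 → ℝ) (z : Fin 3 → ℝ), t 0 ∈ Ioo (-s) s →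
      ∫⁻ F : Fol L → Fin 3 → ℝ,
          ENNReal.ofReal (((1 + (t 0) ^ 2)⁻¹) ^ 2 * gnoDensity ((((![t 1, u.1, u.2] : Fin 3 → ℝ), (![t 2, v 0, v 1] : Fin 3 → ℝ)), (z, F)) : GnoCoord L)) *
            g (t 0, ((((![t 1, u.1, u.2] : Fin 3 → ℝ), (![t 2, v 0, v 1] : Fin 3 → ℝ)), (z, F)) : GnoCoord L)) ≤
        (A * D (t 1, t 2) + T) *
          ENNReal.ofReal (((1 + t 1 ^ 2 + (u.1 ^ 2 + u.2 ^ 2)) ^ 2)⁻¹ * Real.exp (-(c₁ *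
            (16 * (t 0) ^ 2 / (1 + (t 0) ^ 2) + 8 * (t 1) ^ 2 / ((1 + (t 1) ^ 2) * (1 + (t 0) ^ 2)) + 4 * (t 2) ^ 2 / (1 + (t 2) ^ 2)) *
            (u.1 ^ 2 + u.2 ^ 2) / (1 + t 1 ^ 2 + (u.1 ^ 2 + u.2 ^ 2))))) *
          ENNReal.ofReal (((1 + t 2 ^ 2 + (v 0 ^ 2 + v 1 ^ 2)) ^ 2)⁻¹ * Real.exp (-(c₂ * (v 0 ^ 2 + v 1 ^ 2) / (1 + t 2 ^ 2 + (v 0 ^ 2 + v 1 ^ 2))))) *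
          ENNReal.ofReal (gnomonicWeight z * Real.exp (-(c₃ * normSq3 z / (1 + normSq3 z))))) :
    ∫⁻ p in {p : ℝ × GnoCoord L | p.1 ∈ Ioo (-s) s}, g p ∂((volume : Measure (ℝ × GnoCoord L)).withDensity fun p => ENNReal.ofReal (((1 + p.1 ^ 2)⁻¹) ^ 2 * gnoDensity p.2)) ≤
      ENNReal.ofReal (π ^ 2 / c₁ * (π ^ 2 / c₂) * (2 * (∫ w : EuclideanSpace ℝ (Fin 3), ((1 + ‖w‖ ^ 2) ^ 2)⁻¹) / ((1 + c₃) * Real.sqrt (1 + c₃)))) *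
        (A * ((E * ENNReal.ofReal (900 * s ^ (1 / 3 : ℝ) * (2 * ρ) ^ (1 / 3 : ℝ) * (2 * ρ) ^ (1 / 3 : ℝ) * ((2 * ρ) * (2 * ρ))⁻¹) + ENNReal.ofReal s) *
          ∫⁻ p : ℝ × ℝ, D p * ENNReal.ofReal ((1 + p.1 ^ 2)⁻¹ * (1 + p.2 ^ 2)⁻¹)) + T * ENNReal.ofReal (36 * s ^ (1 / 3 : ℝ) + π ^ 2 * s)) := by
  -- the leader Fubini with `W p := A * D p.2 + T`, `r := B₀`
  have hWm : Measurable fun p : ℝ × ℝ × ℝ => A * D p.2 + T := ((hDm.comp measurable_snd).const_mul A).add measurable_const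
  have h1 := lintegral_hubSlab_leader_le (L := L) (S := Ioo (-s) s) measurableSet_Ioo hc₁ hc₂ hc₃ g hg
    (fun p : ℝ × ℝ × ℝ => A * D p.2 + T) hWm
    (fun p : ℝ × ℝ × ℝ => 16 * p.1 ^ 2 / (1 + p.1 ^ 2) + 8 * p.2.1 ^ 2 / ((1 + p.2.1 ^ 2) * (1 + p.1 ^ 2)) + 4 * p.2.2 ^ 2 / (1 + p.2.2 ^ 2))
    measurable_B0 B0_pos_ae hN2
  refine h1.trans (mul_le_mul_right ?_ _)
  -- split the slab integral: `(A·D + T)·φ = A·(D·φ) + T·φ`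
  set φ : ℝ × ℝ × ℝ → ℝ≥0∞ := fun p => ENNReal.ofReal ((1 + p.2.1 ^ 2)⁻¹ * (1 + p.2.2 ^ 2)⁻¹ *
    (16 * p.1 ^ 2 / (1 + p.1 ^ 2) + 8 * p.2.1 ^ 2 / ((1 + p.2.1 ^ 2) * (1 + p.1 ^ 2)) + 4 * p.2.2 ^ 2 / (1 + p.2.2 ^ 2))⁻¹) with hφ
  have hφm : Measurable φ := by rw [hφ]; exact Measurable.ennreal_ofReal (by fun_prop)
  have hsplit : ∫⁻ p in Ioo (-s) s ×ˢ (univ : Set (ℝ × ℝ)), (A * D p.2 + T) * φ p =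
      A * (∫⁻ p in Ioo (-s) s ×ˢ (univ : Set (ℝ × ℝ)), D p.2 * φ p) + T * ∫⁻ p in Ioo (-s) s ×ˢ (univ : Set (ℝ × ℝ)), φ p := by
    have e : ∀ p : ℝ × ℝ × ℝ, (A * D p.2 + T) * φ p = A * (D p.2 * φ p) + T * φ p := fun p => by ring
    simp_rw [e]
    rw [lintegral_add_left (f := fun p : ℝ × ℝ × ℝ => A * (D p.2 * φ p)) (((hDm.comp measurable_snd).mul hφm).const_mul A),
      lintegral_const_mul (f := fun p : ℝ × ℝ × ℝ => D p.2 * φ p) _ ((hDm.comp measurable_snd).mul hφm),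
      lintegral_const_mul (f := φ) _ hφm]
  rw [hsplit]
  -- the matched part: smearing
  have hDpart : ∫⁻ p in Ioo (-s) s ×ˢ (univ : Set (ℝ × ℝ)), D p.2 * φ p ≤
      (E * ENNReal.ofReal (900 * s ^ (1 / 3 : ℝ) * (2 * ρ) ^ (1 / 3 : ℝ) * (2 * ρ) ^ (1 / 3 : ℝ) * ((2 * ρ) * (2 * ρ))⁻¹) + ENNReal.ofReal s) *
        ∫⁻ p : ℝ × ℝ, D p * ENNReal.ofReal ((1 + p.1 ^ 2)⁻¹ * (1 + p.2 ^ 2)⁻¹) := by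
    rw [hφ]; exact slab_le_smeared hs0 hs1 hρ0 hρ1 D hDm hD (E := E)
  -- the tail part: the plain slab
  have hTpart : ∫⁻ p in Ioo (-s) s ×ˢ (univ : Set (ℝ × ℝ)), φ p ≤ ENNReal.ofReal (36 * s ^ (1 / 3 : ℝ) + π ^ 2 * s) := by
    rw [hφ]; exact lintegral_endSlab_le hs0.le hs1
  exact add_le_add (mul_le_mul_right hDpart _) (mul_le_mul_right hTpart _)

end Summit.QuantumFields.YangMills.Theorems.SwapVirialDeficit.SigmaBall

end
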